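import Summits.HodgeConjecture.HodgeConjecture.Cruxes.BlochSeedDiscOne.SeedChecker

/-!
# `Cruxes/BlochSeedDiscOne/SeedCheckerPorteous.lean` — SEED CHECKER v5, satellite §8 of `SeedChecker.lean` (crux
# `EightfoldBlochSeeds.BlochSeedDiscOne`, item stmt-HodgeConjecture-18881): C7 and C5 explicit across the two doors, the
# VIRTUAL Chern character of a two-term datum, and the DEGENERACY (THOM–PORTEOUS) DOOR typed end-to-end under one named law

HONEST FRAMING. Typed by planner seat `hsemireg-c5c8-1` (g4; director-hodge g20 MINT block A5 «C5–C8 as predicates on (design json,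
presentation); flag the vacuous ∕ implied ones; state nothing proved») for the computation cell `pub-hsemireg`. Line of record:
`Cruxes/BlochSeedDiscOne/Lines/birth.lean` 814a6a70c14e831a, stub `stub_rung_pad4_seedAt`. Everything here is a predicate, a structure, a
json move, or an implication whose hypotheses carry ALL the content (anchor kits, word kits, bundles, maps, schemes, the law); NOTHING is
constructed and NOTHING is proved toward HC ∕ HC_CM ∕ HC_AV ∕ №4 ∕ 26512 ∕ 18881 ∕ H2. The C0–C8 dictionary, the doors and their flags are
those of `SeedChecker.lean` (v4 docstring); this file only adds §8.

THIS MODULE = v5 (g4, same seat, 2026-08-29): ONE ADDITIVE SECTION `VFive` (§8) in a SATELLITE file that imports `SeedChecker.lean` v4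
(13437bb9848c3c36) UNCHANGED — a crux workfile is capped at 200 000 bytes and v4 has 173 950, so §8 (≈ 47 kB) cannot live in the same file;
same namespace, so every name below reads `SeedChecker.…` ∕ `SeedChecker.Design.…` exactly as if it did. Nothing of v4 is restated or shadowed. §8.1 C7 EXPLICIT: `isBlochSemiregular_eight_four_iff` —
on the anchor, C7 (`IsBlochSemiregular i (2·4) 4`) IS the surjectivity of the ONE Bloch pairing map `blochPairingMap i 3 5 3 :
H³(S⁴, Ω⁵) → H³(S⁴, 𝓐lt₃(𝓘_Z; Ω⁸|_Z))` (Serre-transpose of Bloch's `π : H¹(Z, 𝒩) → H⁵(S⁴, Ω³)`; MECH, unfolding); the projection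
`Design.SeedCheck.surjective_blochPairingMap`; the rung-`n` form `isBlochSemiregular_two_mul_succ_iff`. §8.2 C5 ACROSS THE DOORS:
`isFiniteLocallyFree_of_hasRank`, `isVectorBundle_of_hasRank` (constant rank ⟹ the sheaf door's C5; MECH) and the kit-level sheaf-door entrance at
the (A1@Z) level `hasHyperbolicBFSheafSeedOn_of_cleanAtSeed` («one object, two doors»: whatever object a realisation produces enters the sheaf door
as soon as it is `I`-semiregular; the H2-type hypothesis is the whole content). §8.3 OBJECT: THE VIRTUAL CHERN CHARACTER of a two-term datum —
`newtonFour` (Newton in degree `4` on an abstract character; `chernFour_eq_newtonFour` is `rfl`), `virtChernFour C X 𝓝 𝓟 = N₄(ch 𝓝 − ch 𝓟)`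
(= Fulton's `Δ⁽⁴⁾_1(c(𝓝 − 𝓟)) = c₄(𝓝 − 𝓟)`, the Thom–Porteous class of the corank-`1` locus of a map between bundles of ranks `a`, `a + 3`),
`VirtCleanAtSeed` ((A1@Z) of `[𝓝] − [𝓟]`; rescale-invariant, `virtCleanAtSeed_smul ∕ _symH_of_hStd`), THE VIRTUAL `W`-COORDINATE THEOREM
`virtChernFour_eq_of_virtCleanAtSeed` (`c₄(𝓝 − 𝓟) = q'·h⁴ + wOf(−6μ)`), `Design.virtCleanAtSeed_of_realisesTensor` ((A1@Z) of the virtual datum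
⟸ (A1) of the design + the two SIDE realisations `T_N`, `T_P` — NO exactness, NO cokernel), and CONTAINMENT of §7.3's road
(`virtChernFour_eq_chernFour_of_shortExact ∕ _biprod`: with a locally free cokernel `𝓕`, `c₄(𝓝 − 𝓟) = c₄(𝓕)`). §8.4 OBJECT: `splitLocus φ` (points
near which `φ : 𝓟 → 𝓝` has a retraction — Mathlib's `SheafOfModules.over`; open, PROVED), `degeneracySet φ` (its complement `D(φ)`; closed; empty for
a globally split `φ`), `IsDegeneracySchemeOf φ i` (closed immersion with image EXACTLY `D(φ)`; the scheme structure is the presenter's — FLAG), and THE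
DEGENERACY-CLASS LOCALISATION LAW `PorteousFourLocalisation C` (a `Prop`, NOT proved, NOT asserted, consumed only as a hypothesis: for bundles of
ranks `a`, `a + 3` and ANY `φ`, `c₄(𝓝 − 𝓟)` is supported on `D(φ)` — Whitney + vanishing above the rank on the split locus; the shadow of Fulton
Thm. 14.4 when `codim D(φ) = 4`; §7.3's `TopChernFourLocalisation` is its case `a = 1`, `𝓟 = 𝒪` in pencil; sanity `virtChernFour_eq_zero_of_retraction`).
§8.5 THE DEGENERACY (THOM–PORTEOUS) DOOR END-TO-END GIVEN THE LAW: `supported_of_degeneracyScheme ∕ supported_symH_of_degeneracyScheme` ((σ)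
object half: `q·h_K⁴ + wOf μ` supported on `D(φ)`, explicit `q`), `Design.seedCheck_of_degeneracyScheme` (C0 + ranks `a`, `a + 3` + (A1@Z) of the
virtual datum with the design's `μ` + the degeneracy scheme passing C5–C7 ⟹ `Design.SeedCheck K i q`), the presentation datum `TwoTermDatum C Φ D' a`
(`𝓟`, `𝓝`, `φ`, ranks, side realisations; `CokernelPresentation.twoTermDatum`), `Design.seedCheck_of_twoTermDegeneracy` (any clean `D'` with
`μ(D') = μ(D)`), `blochSeedDiscOne_of_degeneracySchemes` (hypothesis-carrying, concludes the crux BY NAME). §8.6 JSON: `Design.padApexUp c k` (an apex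
`P`-cell more: `T_P ↦ T_P + k·ch(apex c)`, `μ` and (A1) unchanged, `c_p ↦ c_p − k·c^p`, rank `↦ rank − k`; `classDataR_three_padApexUp`: C0 of `D` ⟹
`ClassDataR 3` of `D↑ = D.padApexUp c 1`) and the door's json screen `Design.PorteousScreen D c` (= HALL₀ of `D↑` given C0, `porteousScreen_iff_hallUp`).
v5 FLAGS: THE POINT OF THE DEGENERACY DOOR is honest evasion, not progress — the realised object is the two-term datum `φ : 𝓟 ⊕ 𝒪(c·h) → 𝓝` itself
(virtual rank `3`), the seed is its corank-`1` locus `D(φ)` (expected codimension `1·4 = 4`; the next stratum has expected codimension `2·5 = 10 > 8`,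
so for a general `φ` it is EMPTY and `D(φ)` is smooth — no numerical obstruction of the `N₂ = W(h, m₁) − 36|μ′|² ≠ 0` kind arises, that one being
specific to rank-`4` bundles whose `c₅, …, c₈` must vanish), and NO cokernel is asked to be locally free — so the two recorded kills of the rank-`4`
bundle road ((R4) `c₅ = ⋯ = c₈ = 0`; «no realisation in the room has a locally free cokernel») do not bear on it; the price is ONE named law of
the same kind as v4's, plus the same object-side C5 (codimension `4` — Kleiman–Bertini given generation of `𝓗om` by sections, i.e. the HALL₀ ∕
capacity side), C6 (integral — Fulton–Lazarsfeld connectedness wants ampleness of `𝓗om(𝓟', 𝓝)`), C7 (Bloch-semiregularity of a determinantal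
`4`-fold in `S⁴` — open, the H2-type content) — NONE of which is proved or claimed here. §8.1–§8.2 are MECH (unfoldings ∕ repackaging, no
content); `IsDegeneracySchemeOf` pins only the support (FLAG); the law is MATH imported as a hypothesis (FLAG); (σ) for the degeneracy door is
IMPLIED by C0 + the side realisations + the law exactly as in v4. Still nothing proved toward HC ∕ HC_CM ∕ HC_AV ∕ №4 ∕ 26512 ∕ 18881 ∕ H2: no
bundle, map or degeneracy scheme is exhibited; the stub stays open.
RANK-8 ROOM: the degeneracy door IS hsemireg-c4-1's cycle door of the rank-`8` room (g2 `C4-DEGENERACY-LOCI-c4-1-g2.md`, this directory;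
director R19.311 «DOMINATED»), typed here for general ranks and two-sided cell realisations; its no-gos of record — THEOREM DL (a trivial
frame `𝒪^m`, `m ≥ 2`, is never Bloch-semiregular), DL₀ (unobstructedness necessary), (D1) (cycle ⟹ sheaf dominance for frames) — are NEITHER
encoded NOR evaded (see the §8 header); `Design.MultiplicityFree` ∕ `Design.PorteousScreenDL` record the letter-level DL hazard (repeated
letters = obstructed summands of the triple's terms) as an ADVISORY screen, nothing more.
-/

noncomputable section

set_option linter.dupNamespace false

open CategoryTheory AlgebraicGeometry
open Literature.AlgebraicGeometry Literature.AlgebraicGeometry.Motives Literature.AlgebraicGeometry.HodgeTheory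
open Literature.AlgebraicTopology.SingularHomology

namespace Summit.HodgeConjecture.HodgeConjecture.Cruxes.BlochSeedDiscOne.SeedChecker

open Summit.HodgeConjecture.HodgeConjecture.Cruxes.BlochSeedDiscOne.Anchor
open Summit.Ventures.HSemireg Summit.Ventures.HSemireg.Pad4Tower

/-! ## §8 v5 (g4, 2026-08-29) — ADDITIVE: C7 and C5 made explicit ACROSS the two doors; the VIRTUAL Chern character of a two-term datum
`φ : 𝓟 → 𝓝`; split ∕ degeneracy loci and THE DEGENERACY (THOM–PORTEOUS) DOOR — the lci door WITHOUT a locally free cokernel and WITHOUT a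
section, given ONE named law; the json move `Design.padApexUp` (a `P`-cell more: rank `4 ↦ 3`). No declaration of §1–§7 is changed.
RANK-8 ROOM RECONCILIATION. The degeneracy door is NOT new to the cell: it is the «cycle door of the rank-`8` room» of hsemireg-c4-1 (g1 §0 (6);
g2, `C4-DEGENERACY-LOCI-c4-1-g2.md` in this directory: `Z = D₄(φ : V → F₀(t))`, `V` a rank-`5` frame with `c(V) = 1`, `F₀` a rank-`8` bundle,
`[Z] = c₄(G − V) = c₄(G)`, LEMMA KC-EN, the FRAME SEQUENCE, and the no-gos THEOREM DL (the trivial frame `V = 𝒪^m`, `m ≥ 2`, is NEVER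
Bloch-semiregular: `dim ker π_{Z∕X} ≥ h^{0,2}(X)·(m² − 1)`), COROLLARY DL₀ (unobstructedness of the bundles is necessary for both doors) and (D1)
(cycle ⟹ sheaf dominance extends to degeneracy loci of frames; director R19.311 «DOMINATED»)). What §8 adds is only the TYPED record, for
arbitrary ranks `(a, a + 3)` with BOTH sides sums of cell bundles (g2's door table §5.3, last row «general two-bundle loci: not analysed»): the
(σ) half with the virtual `W`-coordinate `−6μ`, the chain into `Design.SeedCheck` and the crux by name under one named law, and the json move ∕
screens. None of the no-gos is encoded or evaded: they live inside the hypotheses `hsr` (C7), `hint` (C6), `hreg` (C5) of §8.5, which nothing here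
discharges; and since the door's deformed object is the TRIPLE `(𝓟', 𝓝, φ)`, every repeated letter `L ⊗ ℂ^m`, `m ≥ 2`, of the design is an
obstructed direct summand of a term — DL's shape — so multiplicity-free designs with a fresh apex are the door's natural clients
(`Design.MultiplicityFree`, `Design.PorteousScreenDL`; ADVISORY, DL being proved for the trivial frame only). -/

section VFive

/-! ### §8.1 C7 EXPLICIT: the one linear map the lci door reads on the anchor -/

section CSevenExplicit

variable {E₀ : AbelianVariety ℂ}

/-- **C7 UNFOLDED ON THE ANCHOR.** Bloch-semiregularity of `i : Z ↪ S⁴` read in the `8`-fold `S⁴` in codimension `4`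
(`IsBlochSemiregular i (2 * 4) 4`, the C7 conjunct of `Design.SeedCheck` and of `HasBlochSeedAt 4`) IS the surjectivity of the SINGLE
Bloch pairing map `blochPairingMap i 3 5 3 : H³(S⁴, Ω⁵_{S⁴}) → H³(S⁴, 𝓐lt₃(𝓘_Z; Ω⁸_{S⁴}|_Z))` (`r = p − 1 = 3`, `j = m + 1 = 5`,
`k = m − 1 = 3`, `m = dim Z = 4`; target `≅ H³(Z, Λ³𝒩_{Z∕S⁴} ⊗ ω_{S⁴}|_Z) ≅ H³(Z, 𝒩^∨ ⊗ ω_Z)`), whose Serre transpose is Bloch's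
`π : H¹(Z, 𝒩_{Z∕S⁴}) → H⁵(S⁴, Ω³_{S⁴})` — so C7 = «`π` injective» = «this map surjective». MECH: the tree's `isBlochSemiregular_iff` at
`(n, p) = (8, 4)`; recorded so that the cell's C7 scripts, the presenter and the stub name THE SAME MAP (no choice of `r, m, k` is left).
[cite: BuchweitzFlenner2003, (8.1) (2)] [cite: Bloch1972Semiregularity, (7.2)–(7.4)] -/
theorem isBlochSemiregular_eight_four_iff {Z : Scheme.{0}} (i : Z ⟶ (pad4Anchor E₀).X.left) :
    IsBlochSemiregular i (2 * 4) 4 ↔ Function.Surjective (blochPairingMap i 3 5 3) :=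
  isBlochSemiregular_iff rfl rfl rfl

/-- … the same at every rung `n` of the pad tower (`Sⁿ` read as a `2n`-fold, codimension `n = r + 1`): C7 = surjectivity of
`blochPairingMap i r (r + 2) r`. MECH. [cite: BuchweitzFlenner2003, (8.1) (2)] -/
theorem isBlochSemiregular_two_mul_succ_iff {X : Motives.SchemeOver ℂ} {Z : Scheme.{0}} (i : Z ⟶ X.left) (r : ℕ) :
    IsBlochSemiregular i (2 * (r + 1)) (r + 1) ↔ Function.Surjective (blochPairingMap i r (r + 1 + 1) r) :=
  isBlochSemiregular_iff rfl (by ring) rfl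

variable {ψ₀ : E₀ ⟶ E₀}

/-- the C7 conjunct of the seed checker, as the surjectivity of that one map. MECH (projection + §8.1). -/
theorem Design.SeedCheck.surjective_blochPairingMap {D : Design} {K : AnchorKit E₀ ψ₀} {Z : Scheme.{0}}
    {i : Z ⟶ (pad4Anchor E₀).X.left} {q : ℚ} (h : D.SeedCheck K i q) : Function.Surjective (blochPairingMap i 3 5 3) :=
  (isBlochSemiregular_eight_four_iff i).1 h.2.2.2.2.2.1

end CSevenExplicit

/-! ### §8.2 C5 ACROSS THE DOORS: constant rank ⟹ finite locally free ⟹ vector bundle; the sheaf door at the (A1@Z) level -/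

section CFiveAcross

/-- **C5, lci-door form ⟹ C5, sheaf-door form**: a module of constant rank `r` (`HasRank`, what `TopChernFourLocalisation` ∕
`PorteousFourLocalisation` quantify over) is finite locally free (what `IsISemiregular` and the sheaf-seed checkers need). MECH
(the tree's `HasRank.hasRankLE` + `HasRankLE.isFiniteLocallyFree`). [folklore] -/
theorem isFiniteLocallyFree_of_hasRank {X : Scheme} {𝓕 : X.Modules} {r : ℕ} (h : HasRank 𝓕 r) : IsFiniteLocallyFree 𝓕 :=
  h.hasRankLE.isFiniteLocallyFree

/-- … and a vector bundle (what `ChernCharacterBetti.ch_shortExact` ∕ `ch_biprod` need). MECH. [folklore] -/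
theorem isVectorBundle_of_hasRank {X : Scheme} {𝓕 : X.Modules} {r : ℕ} (h : HasRank 𝓕 r) : IsVectorBundle 𝓕 :=
  h.hasRankLE.isVectorBundle

variable {E₀ : AbelianVariety ℂ} {ψ₀ : E₀ ⟶ E₀} {C : ChernCharacterBetti}

/-- **THE SHEAF DOOR AT THE (A1@Z) LEVEL, ANY RANK** (kit form of `hasBFSheafSeedOn_of_cleanAtSeed`): an anchor kit, a finite locally
free `I`-semiregular `𝓔` on `S⁴` (`4 ∈ I`) and (A1@Z) against `h_std` with `W`-coordinate `μ ≠ 0` give the tree's one-model sheaf seed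
`HasHyperbolicBFSheafSeedOn C 4 1 I` — no design, no presentation, no rank is read. This is the entrance every realisation of §6–§8 may
use AS SOON AS its object is `I`-semiregular («one object, two doors»: the lci door's bundle `𝓕`, the degeneracy door's `𝓝` or `𝓟`, …).
MECH (repackaging; the H2-type semiregularity hypothesis `hsr` is the whole content and stays a hypothesis). -/
theorem hasHyperbolicBFSheafSeedOn_of_cleanAtSeed (hE : E₀.dim = 1) (hψ : ψ₀ ≫ ψ₀ = -(1 • 𝟙 E₀)) (K : AnchorKit E₀ ψ₀)
    {I : Finset ℕ} {𝓔 : (pad4Anchor E₀).X.left.Modules} {μ : GaussianInt} (hμ : μ ≠ 0) (h𝓔 : IsFiniteLocallyFree 𝓔)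
    (h4 : 4 ∈ I) (hsr : IsISemiregular h𝓔 {q' | q' + 1 ∈ I}) (hcl : CleanAtSeed C I K.F (hStd E₀ K.η) 𝓔 μ) :
    HasHyperbolicBFSheafSeedOn C 4 1 I :=
  ⟨pad4Anchor E₀, pad4Action E₀ ψ₀, K.pol.e, K.pol.a, K.F.wOf μ, pad4Anchor_dim hE, pad4Action_comp_self hψ,
    K.pol.a_rational, K.pol.a_ne_zero, K.hyperbolic_symH hE hψ, K.F.wOf_mem _, K.F.wOf_rational _, K.F.wOf_ne_zero hμ,
    hasBFSheafSeedOn_of_cleanAtSeed h𝓔 h4 hsr (cleanAtSeed_symH_of_hStd hE hψ K hcl)⟩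

/-- … for an object of constant rank (C5 in the lci-door form). MECH. -/
theorem hasHyperbolicBFSheafSeedOn_of_cleanAtSeed_of_hasRank (hE : E₀.dim = 1) (hψ : ψ₀ ≫ ψ₀ = -(1 • 𝟙 E₀))
    (K : AnchorKit E₀ ψ₀) {I : Finset ℕ} {𝓔 : (pad4Anchor E₀).X.left.Modules} {μ : GaussianInt} {r : ℕ} (hμ : μ ≠ 0)
    (hrk : HasRank 𝓔 r) (h4 : 4 ∈ I) (hsr : IsISemiregular (isFiniteLocallyFree_of_hasRank hrk) {q' | q' + 1 ∈ I})
    (hcl : CleanAtSeed C I K.F (hStd E₀ K.η) 𝓔 μ) : HasHyperbolicBFSheafSeedOn C 4 1 I :=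
  hasHyperbolicBFSheafSeedOn_of_cleanAtSeed hE hψ K hμ (isFiniteLocallyFree_of_hasRank hrk) h4 hsr hcl

end CFiveAcross

/-! ### §8.3 OBJECT side: the VIRTUAL Chern character of a two-term datum `(𝓝, 𝓟)` — Newton on a character, (A1@Z) for `[𝓝] − [𝓟]`,
the `W`-coordinate `−6μ` -/

section VirtualCharacter

/-- `(c • x)ⁱ = cⁱ • xⁱ` (private copy, as in §4). [cite: HatcherAT2002, §3.2] -/
private theorem cupPowTwo_smul_aux₈ {Y : Type} [TopologicalSpace Y] (c : ℂ) (x : singularCohomology ℂ ℂ Y 2)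
    (i : ℕ) : cupPowTwo (c • x) i = c ^ i • cupPowTwo x i := by
  induction i with
  | zero => rw [cupPowTwo_zero, cupPowTwo_zero, pow_zero, one_smul]
  | succ i ih =>
    rw [cupPowTwo_succ, cupPowTwo_succ, ih]
    simp only [map_smul, LinearMap.smul_apply, smul_smul, pow_succ, mul_comm]

variable {X : Motives.SchemeOver ℂ}

/-- **NEWTON IN DEGREE `4` ON A CHARACTER** `x = (x_p)_p`, `x_p ∈ H^{2p}(X(ℂ); ℂ)` (the shape of `p ↦ ch_p`):
`N₄(x) = (1∕24) x₁⁴ − ½ x₁² ∪ x₂ + ½ x₂ ∪ x₂ + 2 x₁ ∪ x₃ − 6 x₄` — §7.3's `chernFour` with the character abstracted, so that it applies to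
the VIRTUAL character `ch(𝓝) − ch(𝓟)` of a two-term datum (for which no sheaf has that character). A DEFINITION.
[cite: Fulton1998, Example 3.2.3] -/
def newtonFour (x : (p : ℕ) → complexBetti X (2 * p)) : complexBetti X (2 * 4) :=
  (1 / 24 : ℂ) • cupPowTwo (x 1) 4 -
    (1 / 2 : ℂ) • cupProduct (rfl : 2 * 2 + 2 * 2 = 2 * 4) (cupPowTwo (x 1) 2) (x 2) +
    (1 / 2 : ℂ) • cupProduct (rfl : 2 * 2 + 2 * 2 = 2 * 4) (x 2) (x 2) +
    (2 : ℂ) • cupProduct (rfl : 2 * 1 + 2 * 3 = 2 * 4) (x 1) (x 3) -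
    (6 : ℂ) • x 4

/-- §7.3's `chernFour` IS `newtonFour` of the character `p ↦ ch_p(𝓕)`. [`rfl`] -/
theorem chernFour_eq_newtonFour (C : ChernCharacterBetti) (X : Motives.SchemeOver ℂ) (𝓕 : X.left.Modules) :
    chernFour C X 𝓕 = newtonFour (fun p => C.ch X 𝓕 p) :=
  rfl

/-- **THE VIRTUAL FOURTH CHERN CLASS `c₄(𝓝 − 𝓟)`** of a two-term datum on `X`: Newton in degree `4` applied to the virtual character
`ch(𝓝) − ch(𝓟)`. For vector bundles of ranks `a + 3` and `a` this is the degree-`4` Chern class of the virtual bundle `[𝓝] − [𝓟] ∈ K⁰(X)`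
of rank `3`, i.e. the `(1 × 1)`-determinant `Δ⁽⁴⁾_1(c(𝓝 − 𝓟)) = c₄(𝓝 − 𝓟)` of the THOM–PORTEOUS FORMULA for the corank-`1` degeneracy
locus `D_{a−1}(φ)` of a map `φ : 𝓟 → 𝓝` (Fulton Thm. 14.4: `e = a`, `f = a + 3`, `k = a − 1`, expected codimension
`(e − k)(f − k) = 1 · 4 = 4`). A DEFINITION on the real carrier; nothing asserted. [cite: Fulton1998, Thm. 14.4 and Example 3.2.3] -/
def virtChernFour (C : ChernCharacterBetti) (X : Motives.SchemeOver ℂ) (𝓝 𝓟 : X.left.Modules) : complexBetti X (2 * 4) :=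
  newtonFour (fun p => C.ch X 𝓝 p - C.ch X 𝓟 p)

/-- **NEWTON IN `ℚ[h] ⊕ W`, CHARACTER FORM**: `x_p = a_p · h^p` (`p = 1, 2, 3`) and `x₄ = q · h⁴ + w` give `N₄(x) = q' · h⁴ − 6 · w` with
the explicit `q'` (§7.3's `chernFour_eq_of_ch_eq` with the character abstracted; same proof). [cite: Fulton1998, Example 3.2.3] -/
theorem newtonFour_eq_of_eq {x : (p : ℕ) → complexBetti X (2 * p)} {h : complexBetti X 2} {w : complexBetti X (2 * 4)}
    {a₁ a₂ a₃ q : ℂ} (h1 : x 1 = a₁ • cupPowTwo h 1) (h2 : x 2 = a₂ • cupPowTwo h 2) (h3 : x 3 = a₃ • cupPowTwo h 3)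
    (h4 : x 4 = q • cupPowTwo h 4 + w) :
    newtonFour x = (a₁ ^ 4 / 24 - a₁ ^ 2 * a₂ / 2 + a₂ ^ 2 / 2 + 2 * (a₁ * a₃) - 6 * q) • cupPowTwo h 4 - (6 : ℂ) • w := by
  have e1 : x 1 = a₁ • h := by rw [h1, cupPowTwo_one]
  have p22 : cupProduct (rfl : 2 * 2 + 2 * 2 = 2 * 4) (cupPowTwo h 2) (cupPowTwo h 2) = cupPowTwo h 4 :=
    cupProduct_cupPowTwo_cupPowTwo h 2 2 rfl
  have p13 : cupProduct (rfl : 2 * 1 + 2 * 3 = 2 * 4) h (cupPowTwo h 3) = cupPowTwo h 4 := by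
    have e := cupProduct_cupPowTwo_cupPowTwo h 1 3 rfl
    rwa [cupPowTwo_one] at e
  simp only [newtonFour, e1, h2, h3, h4, cupPowTwo_smul_aux₈, map_smul, LinearMap.smul_apply, smul_smul, p22, p13,
    smul_add]
  module

/-- **CONTAINMENT OF THE COKERNEL ROUTE**: for an exact `0 → 𝓟 → 𝓝 → 𝓕 → 0` with `𝓟`, `𝓕` vector bundles, `c₄(𝓝 − 𝓟) = c₄(𝓕)`
(additivity of `ch`, `ChernCharacterBetti.ch_shortExact`): §7.3's zero-scheme ∕ cokernel road is the case «`coker φ` locally free» of the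
degeneracy door below. PROVED. [cite: Fulton1998, Thm. 3.2 (b) and Example 3.2.3] -/
theorem virtChernFour_eq_chernFour_of_shortExact (C : ChernCharacterBetti) {S : ShortComplex X.left.Modules}
    (hS : S.ShortExact) (h₁ : IsVectorBundle S.X₁) (h₃ : IsVectorBundle S.X₃) :
    virtChernFour C X S.X₂ S.X₁ = chernFour C X S.X₃ := by
  have hx : (fun p : ℕ => C.ch X S.X₂ p - C.ch X S.X₁ p) = fun p => C.ch X S.X₃ p :=
    funext fun p => by rw [C.ch_shortExact S hS h₁ h₃ p, add_sub_cancel_left]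
  rw [virtChernFour, hx, chernFour_eq_newtonFour]

/-- … and for a split datum `𝓝 = 𝓟 ⊞ 𝓕`: `c₄((𝓟 ⊞ 𝓕) − 𝓟) = c₄(𝓕)`. PROVED (`ch_biprod`). [cite: Fulton1998, Thm. 3.2 (b)] -/
theorem virtChernFour_biprod (C : ChernCharacterBetti) (𝓟 𝓕 : X.left.Modules) (hP : IsVectorBundle 𝓟)
    (hF : IsVectorBundle 𝓕) : virtChernFour C X (Limits.biprod 𝓟 𝓕) 𝓟 = chernFour C X 𝓕 := by
  have hx : (fun p : ℕ => C.ch X (Limits.biprod 𝓟 𝓕) p - C.ch X 𝓟 p) = fun p => C.ch X 𝓕 p :=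
    funext fun p => by rw [C.ch_biprod 𝓟 𝓕 hP hF p, add_sub_cancel_left]
  rw [virtChernFour, hx, chernFour_eq_newtonFour]

variable {E₀ : AbelianVariety ℂ} {ψ₀ : E₀ ⟶ E₀} {C : ChernCharacterBetti}

/-- **(A1@Z) FOR THE VIRTUAL DATUM `[𝓝] − [𝓟]` in the window `I`**, against `(C, h, F)`, `W`-coordinate `μ`:
`ch_p(𝓝) − ch_p(𝓟) = c_p · h^p` for `p ∈ I ∖ {4}` and `ch₄(𝓝) − ch₄(𝓟) = q · h⁴ + wOf μ`. The degeneracy door's reading of (A1) — on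
the two-term datum, NOT on any cokernel (which need not be a bundle, nor have this character off the split locus). -/
def VirtCleanAtSeed (C : ChernCharacterBetti) (I : Finset ℕ) (F : WeilFrame E₀ ψ₀) (h : complexBetti (pad4Anchor E₀).X 2)
    (𝓝 𝓟 : (pad4Anchor E₀).X.left.Modules) (μ : GaussianInt) : Prop :=
  ∃ (c : ℕ → ℚ) (q : ℚ),
    (∀ p ∈ I, p ≠ 4 → C.ch (pad4Anchor E₀).X 𝓝 p - C.ch (pad4Anchor E₀).X 𝓟 p = ((c p : ℚ) : ℂ) • cupPowTwo h p) ∧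
      C.ch (pad4Anchor E₀).X 𝓝 4 - C.ch (pad4Anchor E₀).X 𝓟 4 = ((q : ℚ) : ℂ) • cupPowTwo h 4 + F.wOf μ

/-- (A1@Z) of `𝓔` is (A1@Z) of the virtual datum `[𝓔] − [0]`-free form: `CleanAtSeed … 𝓔 μ` ⟹ `VirtCleanAtSeed … 𝓔 𝓟 μ` for any `𝓟`
with `ch(𝓟) = 0` in the window — in particular the degenerate datum `𝓟 = 0`. (Book-keeping; `ChernCharacterBetti.ch_eq_zero_of_isZero`.) -/
theorem virtCleanAtSeed_of_cleanAtSeed_of_isZero {I : Finset ℕ} {F : WeilFrame E₀ ψ₀} {h : complexBetti (pad4Anchor E₀).X 2}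
    {𝓔 𝓟 : (pad4Anchor E₀).X.left.Modules} {μ : GaussianInt} (hcl : CleanAtSeed C I F h 𝓔 μ) (h𝓟 : Limits.IsZero 𝓟) :
    VirtCleanAtSeed C I F h 𝓔 𝓟 μ := by
  obtain ⟨c, q, hc, hq⟩ := hcl
  exact ⟨c, q, fun p hpI hp => by rw [C.ch_eq_zero_of_isZero h𝓟, sub_zero, hc p hpI hp],
    by rw [C.ch_eq_zero_of_isZero h𝓟, sub_zero, hq]⟩

/-- (A1@Z) of the virtual datum is insensitive to rescaling `h` by a non-zero rational (checked against `h_std`, consumed against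
`h_K = 2t · h_std`; as `cleanAtSeed_smul`). -/
theorem virtCleanAtSeed_smul {I : Finset ℕ} {F : WeilFrame E₀ ψ₀} {h : complexBetti (pad4Anchor E₀).X 2}
    {𝓝 𝓟 : (pad4Anchor E₀).X.left.Modules} {μ : GaussianInt} (hcl : VirtCleanAtSeed C I F h 𝓝 𝓟 μ) {r : ℚ} (hr : r ≠ 0) :
    VirtCleanAtSeed C I F (((r : ℚ) : ℂ) • h) 𝓝 𝓟 μ := by
  obtain ⟨c, q, hc, hq⟩ := hcl
  have hr' : ∀ p : ℕ, ((r : ℚ) : ℂ) ^ p ≠ 0 := fun p => pow_ne_zero _ (by exact_mod_cast hr)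
  have key : ∀ (p : ℕ) (x : ℚ), ((x : ℚ) : ℂ) • cupPowTwo h p =
      (((x / r ^ p : ℚ)) : ℂ) • cupPowTwo (((r : ℚ) : ℂ) • h) p := by
    intro p x
    rw [cupPowTwo_smul_aux₈, smul_smul, Rat.cast_div, Rat.cast_pow, div_mul_cancel₀ _ (hr' p)]
  refine ⟨fun p => c p / r ^ p, q / r ^ 4, fun p hpI hp => ?_, ?_⟩
  · rw [hc p hpI hp, key p (c p)]
  · rw [hq, key 4 q]

theorem virtCleanAtSeed_symH_of_hStd (hE : E₀.dim = 1) (hψ : ψ₀ ≫ ψ₀ = -(1 • 𝟙 E₀)) {I : Finset ℕ} (K : AnchorKit E₀ ψ₀)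
    {𝓝 𝓟 : (pad4Anchor E₀).X.left.Modules} {μ : GaussianInt} (hcl : VirtCleanAtSeed C I K.F (hStd E₀ K.η) 𝓝 𝓟 μ) :
    VirtCleanAtSeed C I K.F (symH (pad4Action E₀ ψ₀) K.pol.e K.pol.a) 𝓝 𝓟 μ := by
  rw [K.symH_eq hE hψ]
  exact virtCleanAtSeed_smul hcl (mul_ne_zero two_ne_zero K.pol.t_pos.ne')

/-- **THE `W`-COORDINATE THEOREM, VIRTUAL FORM**: (A1@Z) of `[𝓝] − [𝓟]` in a window `⊇ {1, 2, 3}` with `W`-coordinate `μ` ⟹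
**`c₄(𝓝 − 𝓟) = q' · h⁴ + wOf(−6μ)`** — the Porteous class of the corank-`1` locus has `W`-coordinate `−6μ ≠ 0` as soon as `μ ≠ 0`:
it is a genuine Weil class, never a class in `ℚ[h]` ((σ), design half). PROVED (Newton). [cite: Fulton1998, Example 3.2.3 and Thm. 14.4] -/
theorem virtChernFour_eq_of_virtCleanAtSeed {I : Finset ℕ} {F : WeilFrame E₀ ψ₀} {h : complexBetti (pad4Anchor E₀).X 2}
    {𝓝 𝓟 : (pad4Anchor E₀).X.left.Modules} {μ : GaussianInt} (hcl : VirtCleanAtSeed C I F h 𝓝 𝓟 μ) (h1 : 1 ∈ I)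
    (h2 : 2 ∈ I) (h3 : 3 ∈ I) :
    ∃ q' : ℚ, virtChernFour C (pad4Anchor E₀).X 𝓝 𝓟 = ((q' : ℚ) : ℂ) • cupPowTwo h 4 + F.wOf ((-6 : ℤ) * μ) := by
  obtain ⟨c, q, hc, hq⟩ := hcl
  refine ⟨c 1 ^ 4 / 24 - c 1 ^ 2 * c 2 / 2 + c 2 ^ 2 / 2 + 2 * (c 1 * c 3) - 6 * q, ?_⟩
  rw [virtChernFour, newtonFour_eq_of_eq (x := fun p => C.ch (pad4Anchor E₀).X 𝓝 p - C.ch (pad4Anchor E₀).X 𝓟 p)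
    (hc 1 h1 (by decide)) (hc 2 h2 (by decide)) (hc 3 h3 (by decide)) hq, WeilFrame.wOf_intCast_mul, sub_eq_add_neg,
    ← neg_smul]
  congr 1
  · push_cast; ring_nf
  · norm_num

variable {Φ : WordFrame E₀}

/-- a two-term datum whose terms realise the side tensors `T_N(D)`, `T_P(D)` has virtual character `ch(𝓝) − ch(𝓟) =` the class the
design tensor `T(D) = T_N − T_P` names, degree by degree (additivity of `WordFrame.classOf`). -/
theorem ch_sub_ch_eq_classOf_wch {D : Design} {𝓝 𝓟 : (pad4Anchor E₀).X.left.Modules} (hN : RealisesTensor C Φ 𝓝 D.wchN)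
    (hP : RealisesTensor C Φ 𝓟 D.wchP) (p : Fin 9) :
    C.ch (pad4Anchor E₀).X 𝓝 p - C.ch (pad4Anchor E₀).X 𝓟 p = Φ.classOf p D.wch := by
  rw [hN p, hP p, ← map_sub, ← Design.wch_eq_wchN_sub_wchP]

/-- **(A1@Z) OF THE VIRTUAL DATUM ⟸ (A1) OF THE DESIGN + the two side realisations** (no exactness, no cokernel, no bundle hypothesis:
the class side of the degeneracy door is decided by C0's `Clean` once `𝓝`, `𝓟` realise `T_N(D)`, `T_P(D)`), in every window
`I ⊆ {0, …, 8}`, `W`-coordinate `μ(D)`. PROVED. -/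
theorem Design.virtCleanAtSeed_of_realisesTensor {D : Design} {F : WeilFrame E₀ ψ₀} {h : complexBetti (pad4Anchor E₀).X 2}
    (hΦ : Φ.LinksTo F h) (hD : D.Clean) {𝓝 𝓟 : (pad4Anchor E₀).X.left.Modules} (hN : RealisesTensor C Φ 𝓝 D.wchN)
    (hP : RealisesTensor C Φ 𝓟 D.wchP) {I : Finset ℕ} (hI : ∀ p ∈ I, p ≤ 8) : VirtCleanAtSeed C I F h 𝓝 𝓟 D.mu := by
  refine ⟨fun p => if hp : p < 9 then ((D.coeff ⟨p, hp⟩ : ℤ) : ℚ) / ((p.factorial : ℕ) : ℚ) else 0,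
    ((D.coeff 4 : ℤ) : ℚ) / 24, fun p hpI hp4 => ?_, ?_⟩
  · have hp : p < 9 := Nat.lt_succ_of_le (hI p hpI)
    simp only [dif_pos hp]
    exact (ch_sub_ch_eq_classOf_wch hN hP ⟨p, hp⟩).trans (D.classOf_wch_of_ne_four hΦ hD ⟨p, hp⟩ hp4)
  · exact (ch_sub_ch_eq_classOf_wch hN hP 4).trans (D.classOf_wch_four hΦ hD)

end VirtualCharacter

/-! ### §8.4 OBJECT side: the split locus, the degeneracy locus `D(φ)`, «`i : Z ↪ X` is the degeneracy scheme of `φ`», and THE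
DEGENERACY-CLASS LOCALISATION LAW (named, not proved) -/

section DegeneracyLoci

variable {X : Scheme} {𝓟 𝓝 : X.Modules}

/-- **THE SPLIT LOCUS of `φ : 𝓟 → 𝓝`**: the points near which `φ` admits a RETRACTION (`r ∘ φ|_U = id` on some open `U ∋ x`). For
vector bundles of ranks `a ≤ b` on a scheme this is the open set where `φ(x) : 𝓟(x) → 𝓝(x)` is injective on fibres, i.e. `rank φ(x) = a`
(a fibrewise-injective map of bundles is locally a split monomorphism, and conversely); typed through Mathlib's restriction functor
`SheafOfModules.over` (the tree's `Scheme.Modules.overFunctor`), so no fibre, minor or Fitting ideal is needed. A DEFINITION (set-level).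
[cite: Fulton1998, §14.4 and B.3.4] -/
def splitLocus (φ : 𝓟 ⟶ 𝓝) : Set X :=
  {x | ∃ U : X.Opens, x ∈ U ∧ ∃ r : 𝓝.over U ⟶ 𝓟.over U, (Scheme.Modules.overFunctor U).map φ ≫ r = 𝟙 _}

/-- an open set carrying a retraction lies in the split locus. -/
theorem subset_splitLocus_of_retraction (φ : 𝓟 ⟶ 𝓝) (U : X.Opens) (r : 𝓝.over U ⟶ 𝓟.over U)
    (hr : (Scheme.Modules.overFunctor U).map φ ≫ r = 𝟙 _) : (U : Set X) ⊆ splitLocus φ :=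
  fun _ hy => ⟨U, hy, r, hr⟩

/-- the split locus is open. PROVED. -/
theorem isOpen_splitLocus (φ : 𝓟 ⟶ 𝓝) : IsOpen (splitLocus φ) := by
  rw [isOpen_iff_forall_mem_open]
  rintro x ⟨U, hxU, r, hr⟩
  exact ⟨U, subset_splitLocus_of_retraction φ U r hr, U.isOpen, hxU⟩

/-- a GLOBALLY split `φ` (`φ ≫ r = 𝟙`) has split locus everything. PROVED. -/
theorem splitLocus_eq_univ_of_retraction (φ : 𝓟 ⟶ 𝓝) (r : 𝓝 ⟶ 𝓟) (hr : φ ≫ r = 𝟙 𝓟) : splitLocus φ = Set.univ :=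
  Set.eq_univ_of_forall fun _ =>
    ⟨⊤, trivial, (Scheme.Modules.overFunctor ⊤).map r,
      ((Scheme.Modules.overFunctor ⊤).map_comp φ r).symm.trans
        ((congrArg (fun t : 𝓟 ⟶ 𝓟 => (Scheme.Modules.overFunctor ⊤).map t) hr).trans
          ((Scheme.Modules.overFunctor ⊤).map_id 𝓟))⟩

/-- **THE DEGENERACY LOCUS `D(φ)`** = the complement of the split locus: the points where `φ` drops rank (for bundles of ranks
`a ≤ a + 3`: the corank-`≥ 1` locus `D_{a−1}(φ)` of Fulton Ch. 14, expected codimension `(a − (a−1))(a + 3 − (a−1)) = 4`; the next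
stratum `D_{a−2}(φ)` has expected codimension `2 · 5 = 10 > 8 = dim S⁴` — EMPTY for a general `φ` when `𝓗om(𝓟, 𝓝)` is generated by
sections, Kleiman–Bertini ∕ Fulton Example 14.4.10 and §14.4 «for generic `σ` … `D_k(σ)` is Cohen–Macaulay of codimension `(e−k)(f−k)`,
empty where that exceeds `dim X`»). Closed (PROVED). For `φ = s : 𝒪_X → 𝓕` a section of a bundle this is the zero locus `Z(s)` of §7.3
(pencil: a unit section splits exactly where it does not vanish, Nakayama). A DEFINITION (set-level). [cite: Fulton1998, Thm. 14.4 (a)–(c),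
Example 14.4.10] -/
def degeneracySet (φ : 𝓟 ⟶ 𝓝) : Set X :=
  (splitLocus φ)ᶜ

theorem isClosed_degeneracySet (φ : 𝓟 ⟶ 𝓝) : IsClosed (degeneracySet φ) :=
  (isOpen_splitLocus φ).isClosed_compl

theorem degeneracySet_eq_empty_of_retraction (φ : 𝓟 ⟶ 𝓝) (r : 𝓝 ⟶ 𝓟) (hr : φ ≫ r = 𝟙 𝓟) : degeneracySet φ = ∅ := by
  rw [degeneracySet, splitLocus_eq_univ_of_retraction φ r hr, Set.compl_univ]

/-- **«`i : Z ↪ X` IS THE DEGENERACY SCHEME OF `φ`»** — the typed C5∕C6-input of the degeneracy door: `i` is a closed immersion whose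
image is EXACTLY the degeneracy locus `D(φ)`. FLAG (honest): only the SUPPORT is pinned here; the scheme structure on `Z` (Fulton: the
Fitting ∕ `(a)`-minors ideal of `φ`, §14.4) is the PRESENTER'S to choose and is exactly as strong as the conjuncts C5 (regular immersion of
codimension `4`), C6 (integral) and C7 (Bloch-semiregular) then demand of it — for the generic corank-`1` locus the reduced structure is
the determinantal one (Thm. 14.4 (c): `D_k(σ)` reduced, Cohen–Macaulay, smooth off `D_{k−1}(σ) = ∅`). [cite: Fulton1998, §14.4] -/
def IsDegeneracySchemeOf (φ : 𝓟 ⟶ 𝓝) {Z : Scheme} (i : Z ⟶ X) : Prop :=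
  IsClosedImmersion i ∧ Set.range i.base = degeneracySet φ

theorem IsDegeneracySchemeOf.isClosedImmersion {φ : 𝓟 ⟶ 𝓝} {Z : Scheme} {i : Z ⟶ X} (hZ : IsDegeneracySchemeOf φ i) :
    IsClosedImmersion i :=
  hZ.1

theorem IsDegeneracySchemeOf.range_eq {φ : 𝓟 ⟶ 𝓝} {Z : Scheme} {i : Z ⟶ X} (hZ : IsDegeneracySchemeOf φ i) :
    Set.range i.base = degeneracySet φ :=
  hZ.2

end DegeneracyLoci

section PorteousLaw

/-- **THE DEGENERACY-CLASS LOCALISATION LAW at virtual rank `3`, degree `4` — A NAMED STATEMENT (`Prop`) about the Chern character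
theory `C`, NEITHER PROVED NOR ASSERTED HERE** (consumed as `(hlaw : PorteousFourLocalisation C)`): for vector bundles `𝓟`, `𝓝` of
constant ranks `a`, `a + 3` on a complex scheme `X` and ANY map `φ : 𝓟 → 𝓝`, the virtual class `c₄(𝓝 − 𝓟) ∈ H⁸(X(ℂ); ℂ)` is SUPPORTED
ON the degeneracy locus `D(φ)` (vanishes on `(X ∖ D(φ))(ℂ)`). For the intended (topological) instance this holds for EVERY `φ`, general
or not: on the split locus `U`, `𝓝|_U ≅ 𝓟|_U ⊕ 𝓠` with `𝓠` a bundle of rank `3`, so `c₄(𝓝 − 𝓟)|_U = c₄(𝓠) = 0` (Whitney sum and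
vanishing above the rank, Fulton Thm. 3.2 (a), (e)); when `D(φ) = D_{a−1}(φ)` has its expected codimension `4` it is the shadow of the
THOM–PORTEOUS FORMULA `[D_{a−1}(φ)] = Δ⁽⁴⁾_1(c(𝓝 − 𝓟)) ∩ [X] = c₄(𝓝 − 𝓟) ∩ [X]` (Thm. 14.4 (a), (c)) read through the cycle class
(§19.1). §7.3's `TopChernFourLocalisation C` is its case `a = 1`, `𝓟 = 𝒪_X`, `φ = s` (pencil: `D(s) = Z(s)`, `c₄(𝓕 − 𝒪) = c₄(𝓕)`).
NOT derivable from the fields of `ChernCharacterBetti` (no restriction to opens compatible with `complexBetti.restrictCompl`, no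
vanishing above the rank) — hence a NAMED LAW, the degeneracy door's only import. [cite: Fulton1998, Thm. 14.4, Example 14.4.1,
Thm. 3.2 and §19.1] -/
def PorteousFourLocalisation (C : ChernCharacterBetti) : Prop :=
  ∀ (X : Motives.SchemeOver ℂ) (𝓟 𝓝 : X.left.Modules) (a : ℕ), HasRank 𝓟 a → HasRank 𝓝 (a + 3) →
    ∀ φ : 𝓟 ⟶ 𝓝, virtChernFour C X 𝓝 𝓟 ∈ classesSupportedOn X (degeneracySet φ) (2 * 4)

/-- **SANITY OF THE LAW ON SPLIT DATA**: for a GLOBALLY split `φ` the law says `c₄(𝓝 − 𝓟)` is supported on `∅`, i.e. VANISHES — as it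
must (`𝓝 ≅ 𝓟 ⊕ 𝓠`, `rank 𝓠 = 3`, `c₄(𝓠) = 0`): the law carries the vanishing-above-the-rank content that `ChernCharacterBetti` lacks.
PROVED (from the law as hypothesis; `classesSupportedOn_empty`). -/
theorem virtChernFour_eq_zero_of_retraction {C : ChernCharacterBetti} (hlaw : PorteousFourLocalisation C)
    {X : Motives.SchemeOver ℂ} {𝓟 𝓝 : X.left.Modules} {a : ℕ} (hP : HasRank 𝓟 a) (hN : HasRank 𝓝 (a + 3)) (φ : 𝓟 ⟶ 𝓝)
    (r : 𝓝 ⟶ 𝓟) (hr : φ ≫ r = 𝟙 𝓟) : virtChernFour C X 𝓝 𝓟 = 0 := by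
  have h := hlaw X 𝓟 𝓝 a hP hN φ
  rw [degeneracySet_eq_empty_of_retraction φ r hr, classesSupportedOn_empty] at h
  exact (Submodule.mem_bot ℂ).1 h

end PorteousLaw

/-! ### §8.5 THE DEGENERACY (THOM–PORTEOUS) DOOR, END TO END GIVEN THE LAW -/

section PorteousDoor

variable {E₀ : AbelianVariety ℂ} {ψ₀ : E₀ ⟶ E₀} {C : ChernCharacterBetti}

/-- **(σ) OBJECT HALF FROM A DEGENERACY SCHEME, against any frame**: bundles `𝓟`, `𝓝` of ranks `a`, `a + 3` on the anchor, (A1@Z) of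
`[𝓝] − [𝓟]` in a window `⊇ {1, 2, 3}` with `W`-coordinate `μ` against `(h, F)`, a map `φ : 𝓟 → 𝓝` and its degeneracy scheme
`i : Z ↪ S⁴` give — GIVEN the law — **`q · h⁴ + wOf μ` supported on `Z` for an explicit rational `q`** (`= −q'∕6`). NO COKERNEL IS ASKED
TO BE LOCALLY FREE and NO SECTION IS CHOSEN: the realised object is the two-term datum itself; its cokernel is a rank-`3` bundle exactly
off `Z` and is never read. This is what takes the door OUTSIDE the two recorded kills of the rank-`4`-bundle road — (R4) «`c₅ = ⋯ = c₈ = 0`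
for a rank-`4` bundle» (here the virtual rank is `3` and nothing of rank `4` is claimed locally free) and «no realisation in the room has a
locally free cokernel» (here none is needed) — at the price of the SAME kind of named law. PROVED modulo the law. -/
theorem supported_of_degeneracyScheme {I : Finset ℕ} {F : WeilFrame E₀ ψ₀} {h : complexBetti (pad4Anchor E₀).X 2}
    {𝓟 𝓝 : (pad4Anchor E₀).X.left.Modules} {μ : GaussianInt} {a : ℕ} (hlaw : PorteousFourLocalisation C) (hP : HasRank 𝓟 a)
    (hN : HasRank 𝓝 (a + 3)) (hcl : VirtCleanAtSeed C I F h 𝓝 𝓟 μ) (h1 : 1 ∈ I) (h2 : 2 ∈ I) (h3 : 3 ∈ I) (φ : 𝓟 ⟶ 𝓝)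
    {Z : Scheme.{0}} {i : Z ⟶ (pad4Anchor E₀).X.left} (hZ : IsDegeneracySchemeOf φ i) :
    ∃ q : ℚ, ((q : ℚ) : ℂ) • cupPowTwo h 4 + F.wOf μ ∈ classesSupportedOn (pad4Anchor E₀).X (Set.range i.base) (2 * 4) := by
  obtain ⟨q', hq'⟩ := virtChernFour_eq_of_virtCleanAtSeed hcl h1 h2 h3
  have hmem := hlaw (pad4Anchor E₀).X 𝓟 𝓝 a hP hN φ
  rw [← hZ.range_eq, hq', WeilFrame.wOf_intCast_mul] at hmem
  have hmem' := Submodule.smul_mem _ ((((-1 : ℚ) / 6 : ℚ)) : ℂ) hmem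
  refine ⟨-1 / 6 * q', ?_⟩
  convert hmem' using 1
  rw [smul_add, smul_smul, smul_smul, ← Rat.cast_mul, ← Rat.cast_mul]
  norm_num

/-- **… and against the kit's `h_K = symH = 2t · h_std`** (the form `Design.SeedCheck` reads): check (A1@Z) against `h_std`, consume against
`h_K`. -/
theorem supported_symH_of_degeneracyScheme (hE : E₀.dim = 1) (hψ : ψ₀ ≫ ψ₀ = -(1 • 𝟙 E₀)) (K : AnchorKit E₀ ψ₀) {I : Finset ℕ}
    {𝓟 𝓝 : (pad4Anchor E₀).X.left.Modules} {μ : GaussianInt} {a : ℕ} (hlaw : PorteousFourLocalisation C) (hP : HasRank 𝓟 a)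
    (hN : HasRank 𝓝 (a + 3)) (hcl : VirtCleanAtSeed C I K.F (hStd E₀ K.η) 𝓝 𝓟 μ) (h1 : 1 ∈ I) (h2 : 2 ∈ I) (h3 : 3 ∈ I)
    (φ : 𝓟 ⟶ 𝓝) {Z : Scheme.{0}} {i : Z ⟶ (pad4Anchor E₀).X.left} (hZ : IsDegeneracySchemeOf φ i) :
    ∃ q : ℚ, ((q : ℚ) : ℂ) • cupPowTwo (symH (pad4Action E₀ ψ₀) K.pol.e K.pol.a) 4 + K.F.wOf μ ∈
      classesSupportedOn (pad4Anchor E₀).X (Set.range i.base) (2 * 4) :=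
  supported_of_degeneracyScheme hlaw hP hN (virtCleanAtSeed_symH_of_hStd hE hψ K hcl) h1 h2 h3 φ hZ

/-- **THE DEGENERACY DOOR END-TO-END** — predicate to predicate, GIVEN the law: a design `D` passing C0; bundles `𝓟`, `𝓝` of ranks `a`,
`a + 3` on the anchor with (A1@Z) of `[𝓝] − [𝓟]` against `h_std` in a window `⊇ {1, 2, 3}` and THE DESIGN'S `μ`; a map `φ : 𝓟 → 𝓝`
whose DEGENERACY SCHEME `i : Z ↪ S⁴` passes C5 (regular immersion of codimension `4`), C6 (integral, closed points of codimension `≥ 4`)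
and C7 (Bloch-semiregular, §8.1) ⟹ **`D.SeedCheck K i q` for some `q`**, hence (`seedData_of_seedCheck`) the conclusion of
`stub_rung_pad4_seedAt` on that anchor. The (σ) conjunct is DISCHARGED modulo the law; C5–C7 stay hypotheses ON THE DEGENERACY SCHEME
(where, for a general `φ` with `𝓗om(𝓟, 𝓝)` generated by sections, C5 and the reducedness half of C6 are the generic case of
Thm. 14.4 (c) — pencil, object-side). -/
theorem Design.seedCheck_of_degeneracyScheme (hE : E₀.dim = 1) (hψ : ψ₀ ≫ ψ₀ = -(1 • 𝟙 E₀)) {D : Design} (hC0 : D.ClassData)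
    (K : AnchorKit E₀ ψ₀) {I : Finset ℕ} {𝓟 𝓝 : (pad4Anchor E₀).X.left.Modules} {a : ℕ} (hlaw : PorteousFourLocalisation C)
    (hP : HasRank 𝓟 a) (hN : HasRank 𝓝 (a + 3)) (hcl : VirtCleanAtSeed C I K.F (hStd E₀ K.η) 𝓝 𝓟 D.mu) (h1 : 1 ∈ I)
    (h2 : 2 ∈ I) (h3 : 3 ∈ I) (φ : 𝓟 ⟶ 𝓝) {Z : Scheme.{0}} {i : Z ⟶ (pad4Anchor E₀).X.left} (hZ : IsDegeneracySchemeOf φ i)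
    (hreg : IsRegularImmersionOfCodim i 4) (hint : AlgebraicGeometry.IsIntegral Z)
    (hcoh : ∀ z ∈ Set.range i.base, ((4 : ℕ) : ℕ∞) ≤ Order.coheight z) (hsr : IsBlochSemiregular i (2 * 4) 4) :
    ∃ q : ℚ, D.SeedCheck K i q := by
  obtain ⟨q, hq⟩ := supported_symH_of_degeneracyScheme hE hψ K hlaw hP hN hcl h1 h2 h3 φ hZ
  exact ⟨q, hC0, hZ.isClosedImmersion, hreg, hint, hcoh, hsr, hq⟩

variable {Φ : WordFrame E₀}

/-- **A TWO-TERM REALISATION of a design `D'` at `P`-rank `a`** (the degeneracy door's presentation datum, (design json, presentation) ↦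
data): vector bundles `𝓟`, `𝓝` of constant ranks `a`, `a + 3` on the anchor realising the side tensors `T_P(D')`, `T_N(D')` through the word
frame `Φ` (for sums of cell line bundles: `Design.realisesTensor_wchP ∕ _wchN` from a `LetterKit`, §6), and THE MAP `φ : 𝓟 → 𝓝`. No
exactness, no cokernel. (Consistency, pencil: `rank T(D') = (a + 3) − a = 3`, cf. `Design.padApexUp_rank`.) A structure (data), NOT
constructed here. (hsemireg-c4-1 g2's frame room is the case `𝓟 = V` a rank-`5` frame with `c(V) = 1`, `𝓝 = F₀(t)` of rank `8`, `a = 5`: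
there THEOREM DL forbids `V = 𝒪⁵`, and (N1)–(N4) of `C4-DEGENERACY-LOCI-c4-1-g2.md` §5.2 are what C7 of `D(φ)` then requires.)
[cite: Fulton1998, §14.4] -/
structure TwoTermDatum (C : ChernCharacterBetti) (Φ : WordFrame E₀) (D' : Design) (a : ℕ) where
  /-- the `P`-bundle, rank `a` -/
  𝓟 : (pad4Anchor E₀).X.left.Modules
  /-- the `N`-bundle, rank `a + 3` -/
  𝓝 : (pad4Anchor E₀).X.left.Modules
  /-- the map whose degeneracy locus is the seed -/
  φ : 𝓟 ⟶ 𝓝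
  rankP : HasRank 𝓟 a
  rankN : HasRank 𝓝 (a + 3)
  /-- `𝓟` realises `T_P(D')` -/
  realisesP : RealisesTensor C Φ 𝓟 D'.wchP
  /-- `𝓝` realises `T_N(D')` -/
  realisesN : RealisesTensor C Φ 𝓝 D'.wchN

/-- **(A1@Z) OF A TWO-TERM REALISATION** of a clean `D'`, `W`-coordinate `μ(D')`, in every window `⊆ {0, …, 8}`. PROVED (§8.3). -/
theorem TwoTermDatum.virtCleanAtSeed {D' : Design} {a : ℕ} (ρ : TwoTermDatum C Φ D' a) {F : WeilFrame E₀ ψ₀}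
    {h : complexBetti (pad4Anchor E₀).X 2} (hΦ : Φ.LinksTo F h) (hD' : D'.Clean) {I : Finset ℕ} (hI : ∀ p ∈ I, p ≤ 8) :
    VirtCleanAtSeed C I F h ρ.𝓝 ρ.𝓟 D'.mu :=
  Design.virtCleanAtSeed_of_realisesTensor hΦ hD' ρ.realisesN ρ.realisesP hI

/-- **THE DEGENERACY DOOR FROM THE JSON, END TO END, GIVEN THE LAW**: `D` passes C0 (the design of record, rank `4`); `D'` is ANY clean
design with `μ(D') = μ(D)` (the case in point: `D' = D.padApexUp c 1`, one apex `P`-cell more — `Design.padApexUp_mu ∕ _clean ∕ _rank`,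
rank `3`; or its twists `D'(t)`, §7.1); `ρ` is a two-term realisation of `D'` through the word kit; the degeneracy scheme `i : Z ↪ S⁴` of
`ρ.φ` passes C5, C6, C7 ⟹ `D.SeedCheck W.kit i q` for some `q`. The remaining MATHEMATICS is exactly: the cell line bundles (O-cells), the
choice of `φ ∈ Hom(𝓟, 𝓝)` with `D(φ)` of codimension `4`, integral and Bloch-semiregular — and the law. -/
theorem Design.seedCheck_of_twoTermDegeneracy (hE : E₀.dim = 1) (hψ : ψ₀ ≫ ψ₀ = -(1 • 𝟙 E₀)) {D : Design} (hC0 : D.ClassData)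
    (W : WordKit E₀ ψ₀) {D' : Design} (hD' : D'.Clean) (hmu : D'.mu = D.mu) {a : ℕ} (ρ : TwoTermDatum C W.Φ D' a)
    (hlaw : PorteousFourLocalisation C) {Z : Scheme.{0}} {i : Z ⟶ (pad4Anchor E₀).X.left} (hZ : IsDegeneracySchemeOf ρ.φ i)
    (hreg : IsRegularImmersionOfCodim i 4) (hint : AlgebraicGeometry.IsIntegral Z)
    (hcoh : ∀ z ∈ Set.range i.base, ((4 : ℕ) : ℕ∞) ≤ Order.coheight z) (hsr : IsBlochSemiregular i (2 * 4) 4) :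
    ∃ q : ℚ, D.SeedCheck W.kit i q :=
  D.seedCheck_of_degeneracyScheme hE hψ hC0 W.kit hlaw ρ.rankP ρ.rankN
    (hmu ▸ ρ.virtCleanAtSeed W.links hD' le_eight_of_mem_koszulWindow) one_two_three_mem_koszulWindow.1
    one_two_three_mem_koszulWindow.2.1 one_two_three_mem_koszulWindow.2.2 ρ.φ hZ hreg hint hcoh hsr

/-- … so such data on EVERY CM anchor give the crux `BlochSeedDiscOne` BY NAME (hypothesis-carrying; via `blochSeedDiscOne_of_seedChecks`).
Nothing is asserted: no bundle, map or degeneracy scheme is constructed in this file, and the law is a hypothesis. -/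
theorem blochSeedDiscOne_of_degeneracySchemes (hlaw : PorteousFourLocalisation C)
    (h : ∀ (E₀ : AbelianVariety ℂ) (ψ₀ : E₀ ⟶ E₀), E₀.dim = 1 → ψ₀ ≫ ψ₀ = -(1 • 𝟙 E₀) →
      ∃ (D : Design) (_ : D.ClassData) (W : WordKit E₀ ψ₀) (D' : Design) (_ : D'.Clean) (_ : D'.mu = D.mu) (a : ℕ)
        (ρ : TwoTermDatum C W.Φ D' a) (Z : Scheme.{0}) (i : Z ⟶ (pad4Anchor E₀).X.left),
        IsDegeneracySchemeOf ρ.φ i ∧ IsRegularImmersionOfCodim i 4 ∧ AlgebraicGeometry.IsIntegral Z ∧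
          (∀ z ∈ Set.range i.base, ((4 : ℕ) : ℕ∞) ≤ Order.coheight z) ∧ IsBlochSemiregular i (2 * 4) 4) :
    Summit.HodgeConjecture.HodgeConjecture.Theses.EightfoldBlochSeeds.BlochSeedDiscOne :=
  blochSeedDiscOne_of_seedChecks fun E₀ ψ₀ hE hψ => by
    obtain ⟨D, hC0, W, D', hD', hmu, a, ρ, Z, i, hZ, hreg, hint, hcoh, hsr⟩ := h E₀ ψ₀ hE hψ
    obtain ⟨q, hq⟩ := D.seedCheck_of_twoTermDegeneracy hE hψ hC0 W hD' hmu ρ hlaw hZ hreg hint hcoh hsr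
    exact ⟨D, W.kit, Z, i, q, hq⟩

/-- **THE TWO-TERM DATUM OF A COKERNEL PRESENTATION** (containment, data level): the UP display `0 → 𝓟 → 𝓝 → 𝓔 → 0` of §6 with bundle
ranks `a`, `a + 3` IS a two-term datum (`φ` = the display's first map); its degeneracy locus is EMPTY iff the display splits locally
everywhere, and is the non-locally-free locus of `coker φ` in general (pencil) — the degeneracy door does not ask it to be empty. -/
def CokernelPresentation.twoTermDatum {D' : Design} {𝓔 : (pad4Anchor E₀).X.left.Modules} (π : CokernelPresentation C Φ D' 𝓔)
    {a : ℕ} (hP : HasRank π.S.X₁ a) (hN : HasRank π.S.X₂ (a + 3)) : TwoTermDatum C Φ D' a :=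
  ⟨π.S.X₁, π.S.X₂, π.S.f, hP, hN, π.realisesP, π.realisesN⟩

end PorteousDoor

/-! ### §8.6 JSON side: `Design.padApexUp` — one apex `P`-cell more (the two-term datum `(𝓝, 𝓟 ⊕ 𝒪(c·h)^{⊕k})`, rank `4 ↦ 4 − k`) -/

section PadApexUp

namespace Design

/-- **UPPER APEX PADDING `D↑ = D − k·[apex c]` on the `P`-side**: add the apex cell of twist `c` to the `P`-support with multiplicity `k`
(multiplicities off the support normalised to `0` first). The json move that turns a rank-`4` design of record `D = (𝓝, 𝓟)` into the
rank-`3` two-term datum `(𝓝, 𝓟 ⊕ 𝒪(c·h_std))` of the degeneracy door (`k = 1`; the map `𝒪(c·h) → 𝓝` is a section of `𝓝(−c·h)`: the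
twist freedom of §7.1 reappears as the choice of `c`). PROVED: `wchN_padApexUp` (`T_N` unchanged), `wchP_padApexUp`
(`T_P(D↑) = T_P(D) + k·ch(apex c)`), `wch_padApexUp`, `padApexUp_mu` (`μ` unchanged), `padApexUp_clean`, `padApexUp_coeff`
(`c_p(D↑) = c_p(D) − k·c^p`), `padApexUp_rank` (`rank − k`), `padApexUp_positive`. Json-innocent for everything the doors read.
DL HAZARD (hsemireg-c4-1 g2 THEOREM DL ∕ DL₀, `C4-DEGENERACY-LOCI-c4-1-g2.md` §4.2–§4.3): `k ≥ 2`, or `c` the twist of an apex `P`-cell already in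
`D.cfg.upper` (the multiplicities then MERGE to `m_P + k ≥ 2`), puts the repeated free summand `𝒪(c·h) ⊗ ℂ^m` on the `P`-side of the triple
`(𝓟 ⊕ 𝒪(c·h)^{⊕k}, 𝓝, φ)` — obstructed (commuting variety), and a cycle-door kill whenever the obstruction transfer to `H¹(Z, 𝒩)` is injective
(PROVED by c4-1 g2 for the trivial frame; presumed in general). The screens below use `k = 1`; `PorteousScreenDL` also asks `c` fresh. -/
def padApexUp (D : Design) (c k : ℤ) : Design where
  cfg := ⟨D.cfg.lower, insert (apexCell c) D.cfg.upper⟩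
  mN := D.mN
  mP := fun P => (if P ∈ D.cfg.upper then D.mP P else 0) + (if P = apexCell c then k else 0)

/-- `T_N(D↑) = T_N(D)`. [`rfl`] -/
theorem wchN_padApexUp (D : Design) (c k : ℤ) : (D.padApexUp c k).wchN = D.wchN := rfl

/-- **`T_P(D↑) = T_P(D) + k · ch(apex c)`.** -/
theorem wchP_padApexUp (D : Design) (c k : ℤ) : (D.padApexUp c k).wchP = D.wchP + k • (apexCell c).ch := by
  have h1 : ∑ P ∈ insert (apexCell c) D.cfg.upper, (if P ∈ D.cfg.upper then D.mP P else 0) • P.ch =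
      ∑ P ∈ D.cfg.upper, D.mP P • P.ch := by
    rw [← Finset.sum_subset (Finset.subset_insert (apexCell c) D.cfg.upper)
      (fun P _ hP => by rw [if_neg hP, zero_zsmul])]
    exact Finset.sum_congr rfl fun P hP => by rw [if_pos hP]
  have h2 : ∑ P ∈ insert (apexCell c) D.cfg.upper, (if P = apexCell c then k else 0) • P.ch = k • (apexCell c).ch := by
    rw [Finset.sum_congr rfl fun P _ => ite_smul _ _ _ _]
    simp only [zero_zsmul, Finset.sum_ite_eq', Finset.mem_insert_self, if_true]
  simp only [Design.wchP, padApexUp]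
  rw [Finset.sum_congr rfl fun P _ => add_zsmul _ _ _, Finset.sum_add_distrib, h1, h2]

/-- **`T(D↑) = T(D) − k · ch(apex c)`.** -/
theorem wch_padApexUp (D : Design) (c k : ℤ) : (D.padApexUp c k).wch = D.wch - k • (apexCell c).ch := by
  rw [Design.wch_eq_wchN_sub_wchP, Design.wch_eq_wchN_sub_wchP D, wchN_padApexUp, wchP_padApexUp]
  abel

/-- **`μ(D↑) = μ(D)`** (the apex has no `eeee`-coefficient). -/
theorem padApexUp_mu (D : Design) (c k : ℤ) : (D.padApexUp c k).mu = D.mu := by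
  simp only [Design.mu, wch_padApexUp, Pi.sub_apply, Pi.smul_apply,
    MCell.ch_apexCell_of_not_eFree c not_eFree_eWord.1, smul_zero, sub_zero]

/-- **`D↑` is (A1)-clean if `D` is.** -/
theorem padApexUp_clean (D : Design) (hD : D.Clean) (c k : ℤ) : (D.padApexUp c k).Clean := by
  rw [Design.Clean, wch_padApexUp, sub_eq_add_neg, ← neg_smul]
  exact classScreen_add hD (classScreen_zsmul (classScreen_apexCell c) (-k))

/-- **`c_p(D↑) = c_p(D) − k · c^p`.** -/
theorem padApexUp_coeff (D : Design) (c k : ℤ) (p : Fin 9) :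
    (D.padApexUp c k).coeff p = D.coeff p - k * c ^ (p : ℕ) := by
  have h := (D.padApexUp c k).wch_refWord p
  rw [wch_padApexUp, Pi.sub_apply, Pi.smul_apply, D.wch_refWord, MCell.ch_apexCell_of_eFree c (refWord_spec p).1,
    (refWord_spec p).2] at h
  have h' : (((D.coeff p - k * c ^ (p : ℕ) : ℤ)) : GaussianInt) = (((D.padApexUp c k).coeff p : ℤ) : GaussianInt) := by
    rw [← h, zsmul_eq_mul, Int.cast_sub, Int.cast_mul, Int.cast_pow]
  have h'' := congrArg Zsqrtd.re h'
  simpa only [Zsqrtd.re_intCast] using h''.symm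

/-- **`rank(D↑) = rank(D) − k`.** -/
theorem padApexUp_rank (D : Design) (c k : ℤ) : (D.padApexUp c k).rank = D.rank - k := by
  rw [Design.rank_eq_coeff, Design.rank_eq_coeff, padApexUp_coeff]
  simp

/-- positivity survives upper padding with `k > 0`. -/
theorem padApexUp_positive (D : Design) (hD : D.Positive) (c : ℤ) {k : ℤ} (hk : 0 < k) : (D.padApexUp c k).Positive := by
  refine ⟨hD.1, fun P hP => ?_⟩
  simp only [padApexUp, Finset.mem_insert] at hP ⊢
  by_cases h1 : P ∈ D.cfg.upper
  · rw [if_pos h1]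
    have := hD.2 P h1
    split_ifs <;> omega
  · rw [if_neg h1]
    rcases hP with h2 | h2
    · rw [if_pos h2]; simpa using hk
    · exact absurd h2 h1

/-- **the rank-`3` companion of a design of record**: C0 at rank `4` ⟹ `D.padApexUp c 1` is clean, has the same `μ ≠ 0`, rank `3` and
positive multiplicities (`ClassDataR 3`) — the json input of `Design.seedCheck_of_twoTermDegeneracy` with `D' = D.padApexUp c 1`. -/
theorem classDataR_three_padApexUp {D : Design} (h : D.ClassData) (c : ℤ) : (D.padApexUp c 1).ClassDataR 3 :=
  ⟨padApexUp_clean D h.1 c 1, by rw [padApexUp_mu]; exact h.2.1,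
    by rw [padApexUp_rank, h.2.2.1]; norm_num, padApexUp_positive D h.2.2.2 c one_pos⟩

/-- **THE DEGENERACY DOOR'S JSON SCREENS** for a design of record `D` and an apex twist `c` (decidable on a design of record, cell-runnable
with the v4 HALL₀ script): C0 at rank `3` of the companion `D↑ = D.padApexUp c 1` (AUTOMATIC from C0 of `D`: `classDataR_three_padApexUp`)
and HALL₀ (UP) of `D↑` (§7.2's `Design.HallUp`) — the necessary capacity condition for a map `φ : 𝓟 ⊕ 𝒪(c·h) → 𝓝` between the cell bundles
to be injective at the generic point (`D(φ) ≠ S⁴`: every family of `P`-cells, the new apex included, must see at least as many live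
`N`-cells with `Hom ≠ 0`); the apex row reads «`Σ m_N` over the live `N` with `N − apex(c)` effective is `≥ 1`», true for all `c ≪ 0`
(the twist freedom of §7.1, now the freedom in the extra summand). So the ONLY new json condition of the degeneracy door is HALL₀ of `D↑`;
sufficiency (a general `φ` has `D(φ)` of codimension `4`, empty `D_{a−2}`) is object-side (Kleiman–Bertini when `𝓗om(𝓟 ⊕ 𝒪(c·h), 𝓝)` is
generated by sections; Fulton Example 14.4.10 ∕ Thm. 14.4 (c)). [cite: Fulton1998, Thm. 14.4 (c)] -/
def PorteousScreen (D : Design) (c : ℤ) : Prop :=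
  (D.padApexUp c 1).ClassDataR 3 ∧ (D.padApexUp c 1).HallUp

/-- given C0 of `D`, the screen IS HALL₀ of the companion. -/
theorem porteousScreen_iff_hallUp {D : Design} (h : D.ClassData) (c : ℤ) : D.PorteousScreen c ↔ (D.padApexUp c 1).HallUp :=
  ⟨fun hs => hs.2, fun hH => ⟨classDataR_three_padApexUp h c, hH⟩⟩

/-- **MULTIPLICITY-FREE design**: every cell of either support carries multiplicity `≤ 1` — the letter-level shape on which the degeneracy
door's deformed object, the triple `(𝓟 ⊕ 𝒪(c·h), 𝓝, φ)` of sums of cell line bundles, has NO repeated direct summand `L ⊗ ℂ^m`, `m ≥ 2`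
(the obstructed shape of hsemireg-c4-1 g2's THEOREM DL ∕ DL₀). ADVISORY SCREEN, decidable on a design of record: DL is proved for the trivial
frame only; outside it a repeated letter is a presumed, not a proved, kill of C7. (Irrelevant to the sheaf door, whose object `𝓔` forgets the
letters' multiplicities — c4-1 g2 §4.3's caveat.) -/
def MultiplicityFree (D : Design) : Prop :=
  (∀ N ∈ D.cfg.lower, D.mN N ≤ 1) ∧ ∀ P ∈ D.cfg.upper, D.mP P ≤ 1

/-- a FRESH apex (`apexCell c ∉ D.cfg.upper`) with `k = 1` keeps a multiplicity-free design multiplicity-free. -/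
theorem multiplicityFree_padApexUp {D : Design} (h : D.MultiplicityFree) {c : ℤ} (hc : apexCell c ∉ D.cfg.upper) :
    (D.padApexUp c 1).MultiplicityFree := by
  refine ⟨h.1, fun P hP => ?_⟩
  simp only [padApexUp, Finset.mem_insert] at hP ⊢
  by_cases h1 : P ∈ D.cfg.upper
  · rw [if_pos h1]
    have := h.2 P h1
    split_ifs with h2
    · exact absurd (h2 ▸ h1) hc
    · omega
  · rw [if_neg h1]
    rcases hP with h2 | h2
    · rw [if_pos h2]; norm_num
    · exact absurd h2 h1

/-- **THE DEGENERACY DOOR'S SCREEN WITH THE DL HAZARD EXCLUDED** (advisory strengthening of `PorteousScreen`): the apex twist `c` is FRESH and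
the design is multiplicity-free, so the companion `D↑ = D.padApexUp c 1` is multiplicity-free too (`multiplicityFree_padApexUp_of_porteousScreenDL`).
Use `PorteousScreen` as the necessary json screen; use `PorteousScreenDL` to select the door's natural clients. -/
def PorteousScreenDL (D : Design) (c : ℤ) : Prop :=
  D.PorteousScreen c ∧ D.MultiplicityFree ∧ apexCell c ∉ D.cfg.upper

/-- the companion of a DL-screened design is multiplicity-free. -/
theorem multiplicityFree_padApexUp_of_porteousScreenDL {D : Design} {c : ℤ} (h : D.PorteousScreenDL c) :
    (D.padApexUp c 1).MultiplicityFree :=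
  multiplicityFree_padApexUp h.2.1 h.2.2

end Design

end PadApexUp

end VFive

/-! ## Audit: nothing is decided here

THIS MODULE (v5, §8): defs `newtonFour`, `virtChernFour`, `VirtCleanAtSeed`, `splitLocus`, `degeneracySet`, `IsDegeneracySchemeOf` (predicates ∕ constructions on
honest carriers), `PorteousFourLocalisation` (a `Prop` — Fulton Thm. 14.4 ∕ Thm. 3.2 read in Betti cohomology — consumed only as a hypothesis, never
asserted), the structure `TwoTermDatum` (data; none constructed here; `CokernelPresentation.twoTermDatum` repackages a v3 structure), `Design.padApexUp`,
`Design.PorteousScreen`, `Design.MultiplicityFree`, `Design.PorteousScreenDL` (json; the last two an ADVISORY record of hsemireg-c4-1 g2's DL hazard);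
every v5 `theorem` is proved (unfolding, repackaging, Newton by bilinearity ∕ associativity of `∪`, additivity of
`ch` and of `WordFrame.classOf`, openness of a union of opens, functoriality of restriction, submodule closure, json algebra over `ℤ[i]`).
`supported_of_degeneracyScheme`, `Design.seedCheck_of_degeneracyScheme`, `Design.seedCheck_of_twoTermDegeneracy`, `blochSeedDiscOne_of_degeneracySchemes`,
`virtChernFour_eq_zero_of_retraction` carry the law AND (the first four) bundles of ranks `a`, `a + 3` with a map and its degeneracy scheme passing
C5–C7 among their hypotheses (data no one has constructed). No `sorry`, no new axiom, no instance, no notation. -/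

end Summit.HodgeConjecture.HodgeConjecture.Cruxes.BlochSeedDiscOne.SeedChecker

end
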